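import Literature.Analysis.Calculus.DividedDerivatives
import HarnessLib

/-!
# Integrality of Taylor coefficients of rational functions over `ℚ`

Topic `Literature/NumberTheory/Transcendental`. Book-keeping predicate for the arithmetic method
of Chudnovsky–Rukhadze–Hata–Rhin–Viola–Zudilin ([Zudilin2004, §2 and §7]): for a function
`f : ℚ → ℚ` (in practice a rational function regular at an integer point `x`),
`IsDInt d N f x` says that `f` is `C^N` at `x` and `dʲ · 𝒟ⱼ f(x) ∈ ℤ` for all `j ≤ N`
(`𝒟ⱼ = (1/j!) dʲ/dtʲ`, `Literature.Analysis.Calculus.divDeriv`). This is the shape of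
[Zudilin2004, Lemmas 1, 3, 15, 16] ("`D^j · (1/j!) R^{(j)}(-k) ∈ ℤ`"). The predicate is closed
under sums and — by the Leibniz rule for divided derivatives — under products (`IsDInt.mul`,
`IsDInt.prod`), which is how it is applied to products of "bricks" in [Zudilin2004, Lemma 4 and
Lemma 19]; it holds for affine functions with the obvious integrality conditions
(`IsDInt.affine`), is local (`IsDInt.congr`) and translation invariant (`IsDInt.of_comp_add`).
Everything here is PROVED (no named facts). The `p`-adic companion `IsDOrd` is in
`TaylorCoeffPadic.lean`.

## References

* [Zudilin2004] W. Zudilin, *Arithmetic of linear forms involving odd zeta values*, J. Théor.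
  Nombres Bordeaux 16 (2004), 251–291, §2 (Lemmas 1–4), §7 (Lemmas 15–16), §8 (Lemma 19).
-/

noncomputable section

open Finset Filter Literature.Analysis.Calculus
open scoped Nat

namespace Literature.NumberTheory.Transcendental

/-! ### `dʲ 𝒟ⱼ f(x) ∈ ℤ` for `j ≤ N` -/

/-- `IsDInt d N f x`: `f` is `C^N` at `x` and `dʲ · (1/j!) f^{(j)}(x) ∈ ℤ` for every `j ≤ N`
(the shape of [Zudilin2004, Lemmas 15–16]). [cite: Zudilin2004, §7 Lemmas 15–16] -/
structure IsDInt (d : ℕ) (N : ℕ) (f : ℚ → ℚ) (x : ℚ) : Prop where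
  contDiffAt : ContDiffAt ℚ N f x
  isInt : ∀ j ≤ N, ∃ z : ℤ, (d : ℚ) ^ j * divDeriv j f x = z

namespace IsDInt

variable {d N : ℕ} {f g : ℚ → ℚ} {x : ℚ}

/-- Lower the order. [folklore] -/
theorem of_le (h : IsDInt d N f x) {M : ℕ} (hM : M ≤ N) : IsDInt d M f x :=
  ⟨h.contDiffAt.of_le (by exact_mod_cast hM), fun j hj => h.isInt j (hj.trans hM)⟩

/-- Enlarge the denominator: `d ∣ d'`. [folklore] -/
theorem of_dvd (h : IsDInt d N f x) {d' : ℕ} (hd : d ∣ d') : IsDInt d' N f x := by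
  refine ⟨h.contDiffAt, fun j hj => ?_⟩
  obtain ⟨c, rfl⟩ := hd
  obtain ⟨z, hz⟩ := h.isInt j hj
  refine ⟨c ^ j * z, ?_⟩
  push_cast
  rw [← hz, mul_pow]
  ring

/-- The value itself (`j = 0`) is an integer. [folklore] -/
theorem exists_int_eq (h : IsDInt d N f x) : ∃ z : ℤ, f x = z := by
  obtain ⟨z, hz⟩ := h.isInt 0 (Nat.zero_le _)
  exact ⟨z, by simpa using hz⟩

/-- **Closure under products** (Leibniz rule for divided derivatives). [folklore] -/
theorem mul (hf : IsDInt d N f x) (hg : IsDInt d N g x) : IsDInt d N (fun t => f t * g t) x := by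
  refine ⟨hf.contDiffAt.mul hg.contDiffAt, fun j hj => ?_⟩
  have hfj : ContDiffAt ℚ j f x := hf.contDiffAt.of_le (by exact_mod_cast hj)
  have hgj : ContDiffAt ℚ j g x := hg.contDiffAt.of_le (by exact_mod_cast hj)
  rw [divDeriv_fun_mul hfj hgj, mul_sum]
  have hterm : ∀ i ∈ range (j + 1), ∃ z : ℤ,
      (d : ℚ) ^ j * (divDeriv i f x * divDeriv (j - i) g x) = z := by
    intro i hi
    have hij : i ≤ j := Nat.lt_succ_iff.1 (mem_range.1 hi)
    obtain ⟨a, ha⟩ := hf.isInt i (hij.trans hj)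
    obtain ⟨b, hb⟩ := hg.isInt (j - i) ((Nat.sub_le j i).trans hj)
    refine ⟨a * b, ?_⟩
    have : (d : ℚ) ^ j = (d : ℚ) ^ i * (d : ℚ) ^ (j - i) := by
      rw [← pow_add, Nat.add_sub_cancel' hij]
    rw [this]
    push_cast
    rw [← ha, ← hb]
    ring
  choose! z hz using hterm
  refine ⟨∑ i ∈ range (j + 1), z i, ?_⟩
  push_cast
  exact sum_congr rfl hz

/-- The constant function `1`. [folklore] -/
theorem one (d N : ℕ) (x : ℚ) : IsDInt d N (fun _ => (1 : ℚ)) x := by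
  refine ⟨contDiffAt_const, fun j _ => ?_⟩
  rw [divDeriv_const]
  split_ifs with h
  · exact ⟨(d : ℤ) ^ j, by push_cast; ring⟩
  · exact ⟨0, by simp⟩

/-- An integer constant. [folklore] -/
theorem const (d N : ℕ) (c : ℤ) (x : ℚ) : IsDInt d N (fun _ => (c : ℚ)) x := by
  refine ⟨contDiffAt_const, fun j _ => ?_⟩
  rw [divDeriv_const]
  split_ifs with h
  · exact ⟨(d : ℤ) ^ j * c, by push_cast; ring⟩
  · exact ⟨0, by simp⟩

/-- Iterated derivatives of an affine function `q t + c`. [folklore] -/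
theorem _root_.Literature.NumberTheory.Transcendental.iteratedDeriv_affine (q c x : ℚ) (j : ℕ) :
    iteratedDeriv j (fun t : ℚ => q * t + c) x =
      if j = 0 then q * x + c else if j = 1 then q else 0 := by
  have h1 : deriv (fun t : ℚ => q * t + c) = fun _ => q := by
    funext t
    rw [deriv_add_const, deriv_const_mul _ differentiableAt_id, deriv_id'', mul_one]
  rcases j with _ | _ | j
  · simp
  · simp [h1]
  · rw [iteratedDeriv_succ', iteratedDeriv_succ', h1, deriv_const']
    simp

/-- An affine function `q t + c` (`q, c ∈ ℚ`) with `q x + c ∈ ℤ` and `d q ∈ ℤ` satisfies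
`IsDInt d N` at `x`. [folklore] -/
theorem affine (d N : ℕ) {q c x : ℚ} (h0 : ∃ z : ℤ, q * x + c = z) (h1 : ∃ z : ℤ, d * q = z) :
    IsDInt d N (fun t : ℚ => q * t + c) x := by
  have hcd : ContDiffAt ℚ N (fun t : ℚ => q * t + c) x :=
    (contDiffAt_const.mul contDiffAt_id).add contDiffAt_const
  refine ⟨hcd, fun j _ => ?_⟩
  rw [divDeriv, iteratedDeriv_affine]
  rcases j with _ | _ | j
  · obtain ⟨z, hz⟩ := h0
    exact ⟨z, by simp [hz]⟩
  · obtain ⟨z, hz⟩ := h1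
    exact ⟨z, by simp [hz]⟩
  · exact ⟨0, by simp⟩

/-- An integer linear function `a t + b` at an integer point. [folklore] -/
theorem linear (d N : ℕ) (a b m : ℤ) : IsDInt d N (fun t : ℚ => a * t + b) (m : ℚ) :=
  affine d N ⟨a * m + b, by push_cast; ring⟩ ⟨d * a, by push_cast; ring⟩

/-- The linear factor `t + c` (`c ∈ ℤ`) at an integer point. [folklore] -/
theorem add_const (d N : ℕ) (c m : ℤ) : IsDInt d N (fun t : ℚ => t + c) (m : ℚ) := by
  simpa using linear d N 1 c m

/-- Finite products of `IsDInt` functions. [folklore] -/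
theorem prod {ι : Type*} (s : Finset ι) {F : ι → ℚ → ℚ} (h : ∀ i ∈ s, IsDInt d N (F i) x) :
    IsDInt d N (fun t => ∏ i ∈ s, F i t) x := by
  classical
  induction s using Finset.induction_on with
  | empty => simpa using one d N x
  | insert a s ha ih =>
    have := (h a (mem_insert_self a s)).mul (ih fun i hi => h i (mem_insert_of_mem hi))
    simpa [prod_insert ha] using this

/-- Powers. [folklore] -/
theorem pow (h : IsDInt d N f x) (n : ℕ) : IsDInt d N (fun t => f t ^ n) x := by
  induction n with
  | zero => simpa using one d N x
  | succ n ih => simpa [pow_succ] using ih.mul h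

/-- Closure under sums. [folklore] -/
theorem add (hf : IsDInt d N f x) (hg : IsDInt d N g x) : IsDInt d N (fun t => f t + g t) x := by
  refine ⟨hf.contDiffAt.add hg.contDiffAt, fun j hj => ?_⟩
  have hfj : ContDiffAt ℚ j f x := hf.contDiffAt.of_le (by exact_mod_cast hj)
  have hgj : ContDiffAt ℚ j g x := hg.contDiffAt.of_le (by exact_mod_cast hj)
  obtain ⟨a, ha⟩ := hf.isInt j hj
  obtain ⟨b, hb⟩ := hg.isInt j hj
  exact ⟨a + b, by rw [divDeriv_fun_add hfj hgj, mul_add, ha, hb]; push_cast; ring⟩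

/-- Negation. [folklore] -/
theorem neg (hf : IsDInt d N f x) : IsDInt d N (fun t => -f t) x := by
  refine ⟨hf.contDiffAt.neg, fun j hj => ?_⟩
  obtain ⟨a, ha⟩ := hf.isInt j hj
  exact ⟨-a, by rw [divDeriv_neg, mul_neg, ha]; push_cast; ring⟩

/-- Closure under differences. [folklore] -/
theorem sub (hf : IsDInt d N f x) (hg : IsDInt d N g x) : IsDInt d N (fun t => f t - g t) x := by
  simpa [sub_eq_add_neg] using hf.add hg.neg

/-- Integer multiples. [folklore] -/
theorem int_mul (hf : IsDInt d N f x) (c : ℤ) : IsDInt d N (fun t => (c : ℚ) * f t) x := by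
  simpa using (const d N c x).mul hf

/-- Finite sums of `IsDInt` functions. [folklore] -/
theorem sum {ι : Type*} (s : Finset ι) {F : ι → ℚ → ℚ} (h : ∀ i ∈ s, IsDInt d N (F i) x) :
    IsDInt d N (fun t => ∑ i ∈ s, F i t) x := by
  classical
  induction s using Finset.induction_on with
  | empty => simpa using const d N 0 x
  | insert a s ha ih =>
    have := (h a (mem_insert_self a s)).add (ih fun i hi => h i (mem_insert_of_mem hi))
    simpa [sum_insert ha] using this

/-- `IsDInt` only depends on the germ of `f` at `x`. [folklore] -/
theorem congr (hf : IsDInt d N f x) (hfg : f =ᶠ[nhds x] g) : IsDInt d N g x := by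
  refine ⟨hf.contDiffAt.congr_of_eventuallyEq hfg.symm, fun j hj => ?_⟩
  obtain ⟨a, ha⟩ := hf.isInt j hj
  exact ⟨a, by rw [← divDeriv_congr hfg, ha]⟩

/-- Translation: `IsDInt` for `t ↦ f(t + x)` at `0` gives `IsDInt` for `f` at `x`. [folklore] -/
theorem of_comp_add (h : IsDInt d N (fun t => f (t + x)) 0) : IsDInt d N f x := by
  have h1 : ContDiffAt ℚ N (fun t : ℚ => t - x) x := contDiffAt_id.sub contDiffAt_const
  have h2 : ContDiffAt ℚ N (fun s => f (s + x)) ((fun t : ℚ => t - x) x) := by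
    have h0 : (fun t : ℚ => t - x) x = 0 := sub_self x
    rw [h0]
    exact h.contDiffAt
  have hcomp : ContDiffAt ℚ N ((fun s => f (s + x)) ∘ (fun t : ℚ => t - x)) x :=
    ContDiffAt.comp (g := fun s => f (s + x)) (f := fun t : ℚ => t - x) x h2 h1
  have hfun : ((fun s => f (s + x)) ∘ (fun t : ℚ => t - x)) = f := by
    funext t; simp
  rw [hfun] at hcomp
  refine ⟨hcomp, fun j hj => ?_⟩
  obtain ⟨a, ha⟩ := h.isInt j hj
  refine ⟨a, ?_⟩
  rw [← ha, divDeriv_comp_add_const, zero_add]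

end IsDInt

end Literature.NumberTheory.Transcendental
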